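import Summits.BirchSwinnertonDyer.BirchSwinnertonDyer.Theorems.SignedLowerHalvesSmallImageLowerHalfBothSignsRttCharRoadFrame5
import HarnessLib

/-!
# Route `SignedLowerHalves`, crux L `SmallImageLowerHalfBothSigns` (stmt-BirchSwinnertonDyer-23599), line `rtt_w3` v42, row S4‴ — THE MATCH, brick M1b:
# THE FRAME's 𝔞-UNIT IN `ψ`-CURRENCY — `IsUnit (φ₀ (Dθ.nsub 𝔞)) ⟹ ∃ B ∈ 𝒪_S, e(B) = ψ(𝔞) ∧ (N𝔞 − B) ∈ 𝒪_Sˣ`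

INPUTS hand `bsd-inputs-honda-p1` g31 under LEAD `cruxlead-stmt-BirchSwinnertonDyer-23599` g15 (ruling «M1b → honda», 2026-08-31); helper `--supports stmt-BirchSwinnertonDyer-23599`
(width seat `bsd-line-slh-p3-w3` g29's `hval_core`, p827772, slot `hunit`/`B`). THEOREMS ONLY; no definition, no named fact, no instance, no `sorry`. HONEST FRAMING: S4‴, crux L,
crux M and BSD remain OPEN; BSD is proved for NO curve.

WHAT: the road-D frame (`CharRoadFrameProps`, conjunct 16) gives `IsUnit (φ₀ (Dθ.nsub 𝔞))` for the transported `N𝔞 − σ_𝔞 ∈ Λ_{𝒪,2}`; THE MATCH needs Kato's factor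
`N𝔞 − ψ(𝔞)χ(𝔞)⁻¹` to be the value of a Λ-unit, i.e. an element `B ∈ 𝒪_S` with `e(B) = ψ(𝔞) = idealPow ψ 𝔞` and `N𝔞 − B ∈ 𝒪_Sˣ`. Bridge (all mod `𝔪_S`): (i) the twist
`σ` fixes constants and moves `T_i` inside `𝔐 = (𝔪_S, T₁, T₂)` (pins of `CharRoadFrameProps` + `‖χ₀θ′⁻¹(γ) − 1‖ < 1` from `hker`, honda g23's
`SmallImageRttD2Twist.norm_twistUnit_sub_one_lt`), so `IsUnit (φ₀ (σ y)) ↔ IsUnit (cc cc y)` and `cc cc (N𝔞 − σ_𝔞) = N𝔞 − χ₀(σ_𝔞)⁻¹` (`…RttD2UnitAuxIdeal`);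
(ii) `χ₀(σ_𝔞) = ∏_w χ₀(Φ_w)^{e_w}` for arithmetic Frobenii `Φ_w` once `χ₀` is trivial on `Gal(K̄/K(𝔣))` (the v5 frame conjunct; `layerArtin_mul_inv_mem_katoLevelSubgroup`);
(iii) `χ₀(Φ_w)⁻¹ ≡ θ′(Φ_w)⁻¹ = θ(Φ_w)₀₀ = e⁻¹ψ(w)` (hker ⇒ `χ₀ ≡ θ′`; `θ′θ = 1`; the S4 prefix's Frobenius pin of `θ`). So `B := ∏_w θ(Φ_w)₀₀^{e_w}` works.
[cite: JohnsonLeungKings2011, §5.1, §6.1] [cite: Kato2004Asterisque, §15.6 (15.6.3), (15.9.1)] [cite: NeukirchANT1999, Ch. VI §7 (7.3)]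
-/

set_option autoImplicit false
set_option linter.dupNamespace false

noncomputable section

open scoped Classical NumberField
open NumberField IsDedekindDomain Field PowerSeries

namespace Summit.BirchSwinnertonDyer.BirchSwinnertonDyer.Theorems.SmallImageRttD2FrameNsub

open Literature.NumberTheory.GaloisRepresentations Literature.NumberTheory.LFunctions
  Literature.NumberTheory.EllipticCurves Literature.NumberTheory.NumberFields
  Literature.NumberTheory.ComplexMultiplication.EllipticUnits
  Literature.NumberTheory.ComplexMultiplication.EllipticUnits.JohnsonLeungKings2011
  Summit.BirchSwinnertonDyer.BirchSwinnertonDyer.Theorems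

variable {K : Type} [Field K] [NumberField K] {p : ℕ} [Fact p.Prime] (S : Set (PadicAlgCl p))

/-- `‖x‖ < 1 ⇒ x ∈ 𝔪_𝒪` for `x ∈ 𝒪 = 𝒪_{ℚ_p(S)}` (units have norm `1`). [folklore] -/
private theorem mem_maximalIdeal_of_norm_lt_one [IsLocalRing (padicCoeffIntegers S)] (x : padicCoeffIntegers S) (hx : ‖(x : PadicAlgCl p)‖ < 1) :
    x ∈ IsLocalRing.maximalIdeal (padicCoeffIntegers S) := by
  refine (IsLocalRing.mem_maximalIdeal _).mpr fun hu ↦ ?_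
  have h1 := SmallImageRttD2Twist.norm_coe_unit S hu.unit
  rw [IsUnit.unit_spec] at h1
  exact absurd h1 hx.ne

/-- **`χ₀(g)⁻¹ ≡ θ(g)₀₀ (mod 𝔪_𝒪)`** when `θ′ = χ₀` on `Gal(K̄/K̃_∞)` (honda g23: then `‖χ₀θ′⁻¹ − 1‖ < 1` everywhere) and `θ′·θ₀₀ = 1`.
[cite: JohnsonLeungKings2011, §4.1–§4.2] [cite: Washington1997, §13.2] -/
theorem inv_chi_sub_theta_mem_maximalIdeal [IsLocalRing (padicCoeffIntegers S)] (κ₁ κ₂ : ZpExtension K p)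
    (χ₀ θ' : absoluteGaloisGroup K →ₜ* (padicCoeffIntegers S)ˣ) (hker : ∀ τ ∈ ZpExtension.pairKer κ₁ κ₂, θ' τ = χ₀ τ)
    (θ : FramedGaloisRep K (padicCoeffIntegers S) 1)
    (hθ'θ : ∀ g : absoluteGaloisGroup K, ((θ' g : (padicCoeffIntegers S)ˣ) : padicCoeffIntegers S) *
      ((θ g : GL (Fin 1) (padicCoeffIntegers S)) : Matrix (Fin 1) (Fin 1) (padicCoeffIntegers S)) 0 0 = 1)
    (g : absoluteGaloisGroup K) :
    (((χ₀ g)⁻¹ : (padicCoeffIntegers S)ˣ) : padicCoeffIntegers S) -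
        ((θ g : GL (Fin 1) (padicCoeffIntegers S)) : Matrix (Fin 1) (Fin 1) (padicCoeffIntegers S)) 0 0 ∈
      IsLocalRing.maximalIdeal (padicCoeffIntegers S) := by
  -- `u := χ₀ g · (θ' g)⁻¹` satisfies `u − 1 ∈ 𝔪`
  have hu : (((χ₀ g * (θ' g)⁻¹ : (padicCoeffIntegers S)ˣ)) : padicCoeffIntegers S) - 1 ∈ IsLocalRing.maximalIdeal (padicCoeffIntegers S) :=
    mem_maximalIdeal_of_norm_lt_one S _ (by
      rw [AddSubgroupClass.coe_sub, OneMemClass.coe_one]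
      exact SmallImageRttD2Twist.norm_twistUnit_sub_one_lt S κ₁ κ₂ χ₀ θ' hker g)
  -- `θ g ₀₀ = (θ' g)⁻¹`
  have hθinv : ((θ g : GL (Fin 1) (padicCoeffIntegers S)) : Matrix (Fin 1) (Fin 1) (padicCoeffIntegers S)) 0 0 =
      (((θ' g)⁻¹ : (padicCoeffIntegers S)ˣ) : padicCoeffIntegers S) := by
    have h := hθ'θ g
    calc ((θ g : GL (Fin 1) (padicCoeffIntegers S)) : Matrix (Fin 1) (Fin 1) (padicCoeffIntegers S)) 0 0
        = (((θ' g)⁻¹ : (padicCoeffIntegers S)ˣ) : padicCoeffIntegers S) * (((θ' g : (padicCoeffIntegers S)ˣ) : padicCoeffIntegers S) *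
            ((θ g : GL (Fin 1) (padicCoeffIntegers S)) : Matrix (Fin 1) (Fin 1) (padicCoeffIntegers S)) 0 0) := by
          rw [← mul_assoc, Units.inv_mul, one_mul]
      _ = _ := by rw [h, mul_one]
  -- `(χ₀ g)⁻¹ − (θ' g)⁻¹ = −(χ₀ g)⁻¹ (θ' g)⁻¹ · θ' g · (u − 1)` hmm: directly `(χ₀ g)⁻¹ - (θ' g)⁻¹ = -((χ₀ g)⁻¹ * (u - 1))` with `u = χ₀ g (θ' g)⁻¹`
  have hid : (((χ₀ g)⁻¹ : (padicCoeffIntegers S)ˣ) : padicCoeffIntegers S) - (((θ' g)⁻¹ : (padicCoeffIntegers S)ˣ) : padicCoeffIntegers S) =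
      -((((χ₀ g)⁻¹ : (padicCoeffIntegers S)ˣ) : padicCoeffIntegers S) *
        ((((χ₀ g * (θ' g)⁻¹ : (padicCoeffIntegers S)ˣ)) : padicCoeffIntegers S) - 1)) := by
    rw [Units.val_mul, mul_sub, mul_one, ← mul_assoc, ← Units.val_mul, inv_mul_cancel, Units.val_one, one_mul]
    ring
  rw [hθinv, hid]
  exact Submodule.neg_mem _ (Ideal.mul_mem_left _ _ hu)

/-- Congruence of finite products: if `f i ≡ g i (mod I)` for all `i`, then `∏ᶠ f i ^ n i ≡ ∏ᶠ g i ^ n i (mod I)` (finite supports). [folklore] -/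
private theorem finprod_pow_sub_finprod_pow_mem {ι A : Type*} [CommRing A] (I : Ideal A) (f g : ι → A) (n : ι → ℕ)
    (hf : (Function.mulSupport fun i ↦ f i ^ n i).Finite) (hg : (Function.mulSupport fun i ↦ g i ^ n i).Finite)
    (h : ∀ i, f i - g i ∈ I) : (∏ᶠ i, f i ^ n i) - (∏ᶠ i, g i ^ n i) ∈ I := by
  rw [← Ideal.Quotient.eq_zero_iff_mem, map_sub, sub_eq_zero, map_finprod (Ideal.Quotient.mk I) hf, map_finprod (Ideal.Quotient.mk I) hg]
  refine finprod_congr fun i ↦ ?_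
  rw [map_pow, map_pow, (Ideal.Quotient.eq).mpr (h i)]

omit [NumberField K] in
/-- **The Frobenius pin of a rank-one framed representation, read off**: if the arithmetic-Frobenius characteristic polynomial of `θ` at `w` is the image of
`P` with `P.map subtype = X − C c`, then `θ(Φ)₀₀ = c` (as elements of `ℚ̄_p`) for every arithmetic Frobenius `Φ` at a prime above `w`.
[cite: SerreAbelianLadic1968, Ch. I §2.3] -/
theorem coe_apply_eq_of_hasFrobCharpolyAt (θ : FramedGaloisRep K (padicCoeffIntegers S) 1) {w : HeightOneSpectrum (𝓞 K)}
    {P : Polynomial (padicCoeffIntegers S)} {c : PadicAlgCl p} (hP : P.map (padicCoeffIntegers S).subtype = Polynomial.X - Polynomial.C c)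
    (hθ : θ.HasFrobCharpolyAt w P) {𝔓 : Ideal (absIntegers (𝓞 K) K)} (h𝔓 : 𝔓 ∈ w.primesAbove) {Φ : absoluteGaloisGroup K}
    (hΦ : IsArithFrobAt (𝓞 K) Φ 𝔓) :
    ((((θ Φ : GL (Fin 1) (padicCoeffIntegers S)) : Matrix (Fin 1) (Fin 1) (padicCoeffIntegers S)) 0 0 : padicCoeffIntegers S) : PadicAlgCl p) = c := by
  have hchar : FramedRep.charpoly θ Φ = P := hθ 𝔓 h𝔓 Φ hΦ
  have h1 : FramedRep.charpoly θ Φ = Polynomial.X - Polynomial.C (((θ Φ : GL (Fin 1) (padicCoeffIntegers S)) : Matrix (Fin 1) (Fin 1) (padicCoeffIntegers S)) 0 0) := by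
    rw [FramedRep.charpoly, Matrix.charpoly, Matrix.det_fin_one, Matrix.charmatrix_apply_eq]
  have h2 := congrArg (Polynomial.map (padicCoeffIntegers S).subtype) (h1.symm.trans hchar)
  rw [Polynomial.map_sub, Polynomial.map_X, Polynomial.map_C, hP, sub_right_inj, Polynomial.C_inj] at h2
  exact h2

variable (κ₁ κ₂ : ZpExtension K p) {γ₁ γ₂ : absoluteGaloisGroup K} (χ₀ θ' : absoluteGaloisGroup K →ₜ* (padicCoeffIntegers S)ˣ) (𝔣 : Ideal (𝓞 K))
  {σK : K →+* ℂ}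

set_option maxHeartbeats 800000 in
/-- ★★ **M1b — the frame's 𝔞-unit in `ψ`-currency.** In the road-D frame (`θ′ = χ₀` on `Gal(K̄/K̃_∞)`, `χ₀ = 1` on `Gal(K̄/K(𝔣))` — the v5 conjunct —, the twist `σ` with
its three pins, `Dθ.nsub 𝔞 = σ(N𝔞 − σ_𝔞)`, `θ′·θ₀₀ = 1`, and the S4 prefix's pin «arithmetic Frobenius char-poly of `θ` at `w ∤ p𝔪` is `X − e⁻¹ψ(w)`»), for an admissible
`𝔞` prime to `𝔪`: `IsUnit (φ₀ (Dθ.nsub 𝔞))` gives `B ∈ 𝒪_S` with `B = e⁻¹(idealPow ψ 𝔞)` in `ℚ̄_p` and `N𝔞 − B ∈ 𝒪_Sˣ` — the hypothesis `hunit`/`B` of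
`SmallImageRttReciprocity.hval_core`. [cite: JohnsonLeungKings2011, §5.1, §6.1] [cite: Kato2004Asterisque, (15.9.1) (p. 259)] [cite: NeukirchANT1999, Ch. VI §7 (7.3)] -/
theorem exists_isUnit_absNorm_sub_of_isUnit_phi0_nsub [FiniteDimensional ℚ_[p] (padicCoeffField S)] (h𝔣 : 𝔣 ≠ ⊥)
    (hker : ∀ τ ∈ ZpExtension.pairKer κ₁ κ₂, θ' τ = χ₀ τ)
    (hχ𝔣 : ∀ τ ∈ absGaloisFixingSubgroup (rayClassField K 𝔣), χ₀ τ = 1)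
    (D₀ : TwistedIwasawaDataO S κ₁ κ₂ γ₁ γ₂ χ₀ 𝔣 σK) (hθfin : ∃ m : ℕ, 0 < m ∧ ∀ τ : absoluteGaloisGroup K, χ₀ τ ^ m = 1)
    {H0 H1 H2 : Type} [AddCommGroup H0] [Module (IwasawaAlgebraO₂ S) H0] [AddCommGroup H1] [Module (IwasawaAlgebraO₂ S) H1]
    [AddCommGroup H2] [Module (IwasawaAlgebraO₂ S) H2] (Dθ : ZetaSkeleton (IwasawaAlgebraO₂ S) (AuxIdeals p 𝔣) H0 H1 H2)
    (σ : IwasawaAlgebraO₂ S ≃+* IwasawaAlgebraO₂ S)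
    (hσX : σ PowerSeries.X = (PowerSeries.C (PowerSeries.C (((χ₀ γ₁ * (θ' γ₁)⁻¹ : (padicCoeffIntegers S)ˣ)) : padicCoeffIntegers S)) : IwasawaAlgebraO₂ S) * (1 + PowerSeries.X) - 1)
    (hσCX : σ (PowerSeries.C (PowerSeries.X : PowerSeries (padicCoeffIntegers S))) =
      (PowerSeries.C (PowerSeries.C (((χ₀ γ₂ * (θ' γ₂)⁻¹ : (padicCoeffIntegers S)ˣ)) : padicCoeffIntegers S)) : IwasawaAlgebraO₂ S) *
        (1 + (PowerSeries.C (PowerSeries.X : PowerSeries (padicCoeffIntegers S)) : IwasawaAlgebraO₂ S)) - 1)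
    (hσC : ∀ c : padicCoeffIntegers S, σ (PowerSeries.C (PowerSeries.C c : PowerSeries (padicCoeffIntegers S))) = PowerSeries.C (PowerSeries.C c))
    (a : AuxIdeals p 𝔣) (hnsub : Dθ.nsub a = σ ((D₀.toZetaSkeleton (D₀.nsub_regular hθfin)).nsub a))
    (ha : IsUnit (SmallImageRttD2J2.phi0 S (Dθ.nsub a)))
    (θ : FramedGaloisRep K (padicCoeffIntegers S) 1)
    (hθ'θ : ∀ g : absoluteGaloisGroup K, ((θ' g : (padicCoeffIntegers S)ˣ) : padicCoeffIntegers S) *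
      ((θ g : GL (Fin 1) (padicCoeffIntegers S)) : Matrix (Fin 1) (Fin 1) (padicCoeffIntegers S)) 0 0 = 1)
    (e : PadicAlgCl p ≃+* ℂ) (ψ : HeightOneSpectrum (𝓞 K) → ℂ) (𝔪 : Ideal (𝓞 K))
    (hθ : ∀ w : HeightOneSpectrum (𝓞 K), ((p : ℕ) : 𝓞 K) ∉ w.asIdeal → ¬ 𝔪 ≤ w.asIdeal →
      θ.IsUnramifiedAt w ∧ ∃ P : Polynomial (padicCoeffIntegers S),
        P.map (padicCoeffIntegers S).subtype = Polynomial.X - Polynomial.C (e.symm (ψ w)) ∧ θ.HasFrobCharpolyAt w P)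
    (ha𝔪 : IsCoprime a.1 𝔪) :
    ∃ B : padicCoeffIntegers S, (B : PadicAlgCl p) = e.symm (idealPow K ψ a.1) ∧
      IsUnit ((Ideal.absNorm a.1 : padicCoeffIntegers S) - B) := by
  haveI : IsDiscreteValuationRing (padicCoeffIntegers S) := by
    rw [padicCoeffIntegers_eq_unitBall S]; exact LambdaLowerBoundO.isDiscreteValuationRing_unitBall p _
  have ha0 : a.1 ≠ ⊥ := ne_bot_of_isCoprime_katoModulus p 𝔣 (IsTwist.isCoprime_katoModulus_one p 𝔣 a.2)
  -- §1. From `IsUnit (φ₀ (Dθ.nsub a))` to `IsUnit (N𝔞 − χ₀(σ_𝔞)⁻¹)` (residue transport along σ, as in `…RttCharRoadFrame₄`)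
  have hmemmax := mem_maximalIdeal_of_norm_lt_one S
  have hu₁ : ((((χ₀ γ₁ * (θ' γ₁)⁻¹ : (padicCoeffIntegers S)ˣ)) : padicCoeffIntegers S) - 1) ∈ IsLocalRing.maximalIdeal (padicCoeffIntegers S) :=
    hmemmax _ (by rw [AddSubgroupClass.coe_sub, OneMemClass.coe_one]; exact SmallImageRttD2Twist.norm_twistUnit_sub_one_lt S _ κ₂ χ₀ θ' hker γ₁)
  have hu₂ : ((((χ₀ γ₂ * (θ' γ₂)⁻¹ : (padicCoeffIntegers S)ˣ)) : padicCoeffIntegers S) - 1) ∈ IsLocalRing.maximalIdeal (padicCoeffIntegers S) :=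
    hmemmax _ (by rw [AddSubgroupClass.coe_sub, OneMemClass.coe_one]; exact SmallImageRttD2Twist.norm_twistUnit_sub_one_lt S _ κ₂ χ₀ θ' hker γ₂)
  let cc2 : IwasawaAlgebraO₂ S →+* padicCoeffIntegers S :=
    (PowerSeries.constantCoeff : PowerSeries (padicCoeffIntegers S) →+* padicCoeffIntegers S).comp
      (PowerSeries.constantCoeff : IwasawaAlgebraO₂ S →+* PowerSeries (padicCoeffIntegers S))
  have hcc2X : cc2 PowerSeries.X = 0 := by
    change PowerSeries.constantCoeff (PowerSeries.constantCoeff (PowerSeries.X : IwasawaAlgebraO₂ S)) = 0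
    rw [PowerSeries.constantCoeff_X, map_zero]
  have hcc2CX : cc2 (PowerSeries.C (PowerSeries.X : PowerSeries (padicCoeffIntegers S))) = 0 := by
    change PowerSeries.constantCoeff (PowerSeries.constantCoeff (PowerSeries.C (PowerSeries.X : PowerSeries (padicCoeffIntegers S)) : IwasawaAlgebraO₂ S)) = 0
    rw [PowerSeries.constantCoeff_C, PowerSeries.constantCoeff_X]
  have hcc2CC : ∀ c : padicCoeffIntegers S, cc2 (PowerSeries.C (PowerSeries.C c : PowerSeries (padicCoeffIntegers S))) = c := fun c ↦ by
    change PowerSeries.constantCoeff (PowerSeries.constantCoeff (PowerSeries.C (PowerSeries.C c : PowerSeries (padicCoeffIntegers S)) : IwasawaAlgebraO₂ S)) = c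
    rw [PowerSeries.constantCoeff_C, PowerSeries.constantCoeff_C]
  have hσX𝔪 : cc2 (σ PowerSeries.X) ∈ IsLocalRing.maximalIdeal (padicCoeffIntegers S) := by
    rw [hσX, map_sub, map_mul, map_add, map_one, hcc2X, add_zero, mul_one, hcc2CC]
    exact hu₁
  have hσCX𝔪 : cc2 (σ (PowerSeries.C (PowerSeries.X : PowerSeries (padicCoeffIntegers S)))) ∈ IsLocalRing.maximalIdeal (padicCoeffIntegers S) := by
    rw [hσCX, map_sub, map_mul, map_add, map_one, hcc2CX, add_zero, mul_one, hcc2CC]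
    exact hu₂
  have hdecomp : ∀ y : IwasawaAlgebraO₂ S, ∃ (c : padicCoeffIntegers S) (G : IwasawaAlgebraO₂ S) (H : PowerSeries (padicCoeffIntegers S)),
      y = PowerSeries.C (PowerSeries.C c) + G * PowerSeries.X + PowerSeries.C (H * PowerSeries.X) := fun y ↦ by
    refine ⟨PowerSeries.constantCoeff (PowerSeries.constantCoeff y), PowerSeries.mk fun n ↦ PowerSeries.coeff (n + 1) y,
      PowerSeries.mk fun n ↦ PowerSeries.coeff (n + 1) (PowerSeries.constantCoeff y), ?_⟩
    have h1 := PowerSeries.eq_shift_mul_X_add_const y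
    have h2 := PowerSeries.eq_shift_mul_X_add_const (PowerSeries.constantCoeff y)
    conv_lhs => rw [h1]
    conv_lhs => rw [h2]
    rw [map_add, map_mul]
    ring
  have hψ2 : ∀ y : IwasawaAlgebraO₂ S, (cc2.comp σ.toRingHom) y - cc2 y ∈ IsLocalRing.maximalIdeal (padicCoeffIntegers S) := fun y ↦ by
    obtain ⟨c, G, H, hy⟩ := hdecomp y
    have hA : cc2 y = c := by
      rw [hy]; simp only [map_add, map_mul, hcc2CC, hcc2X, hcc2CX, mul_zero, add_zero]
    have hB : cc2 (σ y) = c + cc2 (σ G) * cc2 (σ PowerSeries.X) +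
        cc2 (σ (PowerSeries.C H)) * cc2 (σ (PowerSeries.C (PowerSeries.X : PowerSeries (padicCoeffIntegers S)))) := by
      rw [hy]; simp only [map_add, map_mul, hσC, hcc2CC]
    have hval : (cc2.comp σ.toRingHom) y - cc2 y = cc2 (σ G) * cc2 (σ PowerSeries.X) +
        cc2 (σ (PowerSeries.C H)) * cc2 (σ (PowerSeries.C (PowerSeries.X : PowerSeries (padicCoeffIntegers S)))) := by
      rw [RingHom.comp_apply, RingEquiv.toRingHom_eq_coe, RingHom.coe_coe, hB, hA]; ring
    rw [hval]
    exact Ideal.add_mem _ (Ideal.mul_mem_left _ _ hσX𝔪) (Ideal.mul_mem_left _ _ hσCX𝔪)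
  have hiff := SmallImageRttD2LamSpec.isUnit_iff_of_sub_mem_maximalIdeal (cc2.comp σ.toRingHom) cc2 hψ2
    ((D₀.toZetaSkeleton (D₀.nsub_regular hθfin)).nsub a)
  have hccmap : ∀ y : IwasawaAlgebraO₂ S, PowerSeries.constantCoeff (SmallImageRttD2J2.phi0 S y) = cc2 y := fun y ↦ by
    change PowerSeries.constantCoeff (PowerSeries.map _ y) = PowerSeries.constantCoeff (PowerSeries.constantCoeff y)
    rw [← PowerSeries.coeff_zero_eq_constantCoeff_apply (PowerSeries.map _ y), PowerSeries.coeff_map, PowerSeries.coeff_zero_eq_constantCoeff_apply]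
  have hunit₀ : IsUnit ((Ideal.absNorm a.1 : padicCoeffIntegers S) - (((thetaArtinO S χ₀ 𝔣 a)⁻¹ : (padicCoeffIntegers S)ˣ) : padicCoeffIntegers S)) := by
    have h := PowerSeries.isUnit_iff_constantCoeff.mp ha
    rw [hccmap, hnsub] at h
    have h' := hiff.mp h
    rwa [show (D₀.toZetaSkeleton (D₀.nsub_regular hθfin)).nsub a = D₀.nsub a from rfl,
      show cc2 (D₀.nsub a) = PowerSeries.constantCoeff (PowerSeries.constantCoeff (D₀.nsub a)) from rfl,
      SmallImageRttD2LamSpec.constantCoeff_constantCoeff_nsub] at h'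
  -- §2. Arithmetic Frobenii at the primes, and the candidate `B`
  have hfrob : ∀ w : HeightOneSpectrum (𝓞 K), ∃ (𝔓 : Ideal (absIntegers (𝓞 K) K)) (Φ : absoluteGaloisGroup K), 𝔓 ∈ w.primesAbove ∧ IsArithFrobAt (𝓞 K) Φ 𝔓 :=
    fun w ↦ by
      obtain ⟨Φ, hΦ⟩ := HeightOneSpectrum.exists_isArithFrobAt_of_mem_primesAbove_holds (adicCompletionPrime_mem_primesAbove K w)
      exact ⟨_, Φ, adicCompletionPrime_mem_primesAbove K w, hΦ⟩
  choose 𝔓 Φ h𝔓 hΦ using hfrob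
  let t : HeightOneSpectrum (𝓞 K) → padicCoeffIntegers S := fun w ↦
    ((θ (Φ w) : GL (Fin 1) (padicCoeffIntegers S)) : Matrix (Fin 1) (Fin 1) (padicCoeffIntegers S)) 0 0
  let n : HeightOneSpectrum (𝓞 K) → ℕ := fun w ↦ (Associates.mk w.asIdeal).count (Associates.mk a.1).factors
  have hfin : (Function.mulSupport fun w ↦ t w ^ n w).Finite := by
    refine (Filter.eventually_cofinite.mp (Associates.finite_factors ha0)).subset fun w hw ↦ ?_
    rw [Function.mem_mulSupport] at hw
    intro h0
    have h0' : n w = 0 := by exact_mod_cast h0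
    exact hw (by rw [h0', pow_zero])
  -- primes dividing `𝔞` are away from `p` and from `𝔪`, `𝔣`
  have hdiv : ∀ w : HeightOneSpectrum (𝓞 K), n w ≠ 0 → a.1 ≤ w.asIdeal := fun w hw ↦
    Ideal.le_of_dvd ((Associates.count_ne_zero_iff_dvd ha0 w.irreducible).mp hw)
  have hwp : ∀ w : HeightOneSpectrum (𝓞 K), n w ≠ 0 → ((p : ℕ) : 𝓞 K) ∉ w.asIdeal := fun w hw hpw ↦ by
    have hcop := IsTwist.isCoprime_katoModulus_one p 𝔣 a.2
    have hle : a.1 ⊔ katoModulus p 𝔣 1 ≤ w.asIdeal := sup_le (hdiv w hw) (by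
      rw [katoModulus, pow_one]
      exact Ideal.mul_le_right.trans ((Ideal.span_singleton_le_iff_mem _).mpr hpw))
    rw [Ideal.isCoprime_iff_sup_eq.mp hcop, top_le_iff] at hle
    exact w.isPrime.ne_top hle
  have hw𝔪 : ∀ w : HeightOneSpectrum (𝓞 K), n w ≠ 0 → ¬ 𝔪 ≤ w.asIdeal := fun w hw hle ↦ by
    have hle' : a.1 ⊔ 𝔪 ≤ w.asIdeal := sup_le (hdiv w hw) hle
    rw [Ideal.isCoprime_iff_sup_eq.mp ha𝔪, top_le_iff] at hle'
    exact w.isPrime.ne_top hle'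
  have hw𝔣 : ∀ w : HeightOneSpectrum (𝓞 K), n w ≠ 0 → ¬ katoModulus p 𝔣 0 ≤ w.asIdeal := fun w hw hle ↦ by
    have hcop := IsTwist.isCoprime_katoModulus_one p 𝔣 a.2
    have hle' : a.1 ⊔ katoModulus p 𝔣 1 ≤ w.asIdeal := sup_le (hdiv w hw) ((katoModulus_anti p 𝔣 (Nat.zero_le 1)).trans hle)
    rw [Ideal.isCoprime_iff_sup_eq.mp hcop, top_le_iff] at hle'
    exact w.isPrime.ne_top hle'
  refine ⟨∏ᶠ w, t w ^ n w, ?_, ?_⟩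
  · -- `↑B = e⁻¹(idealPow ψ 𝔞)` factorwise
    rw [show (((∏ᶠ w, t w ^ n w : padicCoeffIntegers S)) : PadicAlgCl p) = (padicCoeffIntegers S).subtype (∏ᶠ w, t w ^ n w) from rfl,
      map_finprod _ hfin, idealPow, map_finprod e.symm (mulSupport_idealPow_finite ψ ha0)]
    refine finprod_congr fun w ↦ ?_
    by_cases hw : n w = 0
    · simp only [t, n, hw, pow_zero, map_one]
    · obtain ⟨-, P, hP, hθP⟩ := hθ w (hwp w hw) (hw𝔪 w hw)
      simp only [t, n, map_pow, Subring.subtype_apply]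
      exact congrArg (· ^ n w) (coe_apply_eq_of_hasFrobCharpolyAt S θ hP hθP (h𝔓 w) (hΦ w))
  · -- `IsUnit (N𝔞 − B)` from `hunit₀`, since `B ≡ χ₀(σ_𝔞)⁻¹ (mod 𝔪)`
    refine SmallImageRttD2AuxIdeal.isUnit_of_sub_mem_maximalIdeal hunit₀ ?_
    rw [sub_sub_sub_cancel_left]
    -- `χ₀(σ_𝔞) = ∏ χ₀(Φ_w)^{n w}` : χ₀ ∘ layerLift is a hom on `Gal(K(𝔣)/K)` since `χ₀` kills `Gal(K̄/K(𝔣))`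
    have hχ0 : ∀ τ ∈ katoLevelSubgroup p 𝔣 0, χ₀ τ = 1 := fun τ hτ ↦ by
      refine hχ𝔣 τ ?_
      have h : katoLevelSubgroup p 𝔣 0 ≤ absGaloisFixingSubgroup (rayClassField K 𝔣) := by
        change absGaloisFixingSubgroup (rayClassField K (katoModulus p 𝔣 0)) ≤ _
        rw [katoModulus_zero]
      exact h hτ
    let χL : (katoLayer p 𝔣 0 ≃ₐ[K] katoLayer p 𝔣 0) →* (padicCoeffIntegers S)ˣ :=
      { toFun := fun τ ↦ χ₀ (layerLift p 𝔣 0 τ)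
        map_one' := by
          have hmem : layerLift p 𝔣 0 1 ∈ katoLevelSubgroup p 𝔣 0 := by
            change absRestrictNormalHom (katoLayer p 𝔣 0) (layerLift p 𝔣 0 1) = 1
            exact absRestrictNormalHom_layerLift p 𝔣 0 1
          exact hχ0 _ hmem
        map_mul' := fun τ₁ τ₂ ↦ by
          have hmem : layerLift p 𝔣 0 (τ₁ * τ₂) * (layerLift p 𝔣 0 τ₁ * layerLift p 𝔣 0 τ₂)⁻¹ ∈ katoLevelSubgroup p 𝔣 0 :=
            SmallImageRttD2AuxIdeal.mul_inv_mem_katoLevelSubgroup_of_absRestrictNormalHom_eq 0 (by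
              rw [map_mul, absRestrictNormalHom_layerLift, absRestrictNormalHom_layerLift, absRestrictNormalHom_layerLift])
          have h := hχ0 _ hmem
          rw [map_mul, map_inv, mul_inv_eq_one, map_mul] at h
          exact h }
    have hχL : ∀ τ, χL τ = χ₀ (layerLift p 𝔣 0 τ) := fun _ ↦ rfl
    have hArt : thetaArtinO S χ₀ 𝔣 a = ∏ᶠ w, χ₀ (Φ w) ^ n w := by
      rw [thetaArtinO, layerArtin, ← hχL, Literature.NumberTheory.ComplexMultiplication.EllipticUnits.map_artinSymbol χL _ ha0, Literature.NumberTheory.LFunctions.AbelianDensity.artinSymbol]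
      refine finprod_congr fun w ↦ ?_
      by_cases hw : n w = 0
      · simp only [Function.comp_apply, n, hw, pow_zero]
      · change χL (galFrob K (katoLayer p 𝔣 0) w) ^ n w = χ₀ (Φ w) ^ n w
        congr 1
        rw [hχL, ← Literature.NumberTheory.LFunctions.AbelianDensity.artinSymbol_asIdeal (galFrob K (katoLayer p 𝔣 0)) w]
        change χ₀ (layerArtin p 𝔣 0 w.asIdeal) = χ₀ (Φ w)
        have hmem := SmallImageRttD2AuxIdeal.layerArtin_mul_inv_mem_katoLevelSubgroup h𝔣 0 (hw𝔣 w hw) (h𝔓 w) (hΦ w)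
        have h := hχ0 _ hmem
        rwa [map_mul, map_inv, mul_inv_eq_one] at h
    -- `↑(χ₀(σ_𝔞))⁻¹ = ∏ ↑(χ₀(Φ_w))⁻¹ ^ n w` in `𝒪`
    have hfinχ : (Function.mulSupport fun w ↦ (χ₀ (Φ w))⁻¹ ^ n w).Finite := by
      refine (Filter.eventually_cofinite.mp (Associates.finite_factors ha0)).subset fun w hw ↦ ?_
      rw [Function.mem_mulSupport] at hw
      intro h0
      have h0' : n w = 0 := by exact_mod_cast h0
      exact hw (by rw [h0', pow_zero])
    have hinv : (((thetaArtinO S χ₀ 𝔣 a)⁻¹ : (padicCoeffIntegers S)ˣ) : padicCoeffIntegers S) =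
        ∏ᶠ w, ((((χ₀ (Φ w))⁻¹ : (padicCoeffIntegers S)ˣ)) : padicCoeffIntegers S) ^ n w := by
      rw [hArt, ← finprod_inv_distrib]
      simp_rw [← inv_pow]
      rw [← Units.coeHom_apply, map_finprod _ hfinχ]
      refine finprod_congr fun w ↦ ?_
      rw [map_pow, Units.coeHom_apply]
    have hfinχ' : (Function.mulSupport fun w ↦ ((((χ₀ (Φ w))⁻¹ : (padicCoeffIntegers S)ˣ)) : padicCoeffIntegers S) ^ n w).Finite := by
      refine (Filter.eventually_cofinite.mp (Associates.finite_factors ha0)).subset fun w hw ↦ ?_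
      rw [Function.mem_mulSupport] at hw
      intro h0
      have h0' : n w = 0 := by exact_mod_cast h0
      exact hw (by rw [h0', pow_zero])
    rw [hinv]
    exact finprod_pow_sub_finprod_pow_mem _ _ _ n hfinχ' hfin fun w ↦
      inv_chi_sub_theta_mem_maximalIdeal S κ₁ κ₂ χ₀ θ' hker θ hθ'θ (Φ w)

end Summit.BirchSwinnertonDyer.BirchSwinnertonDyer.Theorems.SmallImageRttD2FrameNsub

end
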